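import Literature.Analysis.FunctionSpaces.PoissonMappingHomeomorph
import Literature.Analysis.FunctionSpaces.PoissonPointProcessUniqueness
import Mathlib.MeasureTheory.Measure.Prod

/-!
# Invariance of the Poisson hub under volume-preserving homeomorphisms (twists)

Helper file for the crux `QuadrupoleSelectionRule` (stmt-CriticalPhenomena-7029, informal) of route
`CardyFlipRusso` (sub-problem `CardyFormulaZ2`), line `Sketch`: the symmetry lever shared by the
crux idea cards `twist-filter-scalar-gap` (first lemmas `TwistInvariance`,
`VolumePreservingPushforward`) and `average-first-odd-sector-gap`, in the homeomorphic setting —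
a Poisson process of Lebesgue intensity on `ℂ`, and the pair (black nuclei, white nuclei) of two
independent such processes, is invariant in law under the image map `c ↦ e '' c` of every
homeomorphism `e : ℂ ≃ₜ ℂ` preserving Lebesgue measure (twists: rotate `B(z,r)` by `α`,
interpolate the angle on `r ≤ |w - z| ≤ R`, identity outside; translations; rotations).

Everything follows from the Mapping Theorem for homeomorphisms
(`IsPoissonPointProcess.mapHomeomorph'`, proved) and Rényi–Kingman uniqueness
(`IsPoissonPointProcess.unique_holds`, proved); no named fact is used.
-/

noncomputable section

open MeasureTheory ProbabilityTheory

namespace Summit.CriticalPhenomena.CardyFormulaZ2.Theorems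

open Literature.Analysis.FunctionSpaces

/-- **A volume-preserving homeomorphism preserves the law of the Poisson process of Lebesgue
intensity.** [folklore] -/
theorem poisson_map_mapHomeomorph_eq (P : Measure (PointConfig ℂ))
    (hP : IsPoissonPointProcess (volume : Measure ℂ) P) (e : ℂ ≃ₜ ℂ)
    (he : Measure.map e (volume : Measure ℂ) = volume) :
    P.map (PointConfig.mapHomeomorph e) = P := by
  have h := hP.mapHomeomorph' e
  rw [he] at h
  exact (IsPoissonPointProcess.unique_holds hP h).symm

/-- **`VolumePreservingPushforward`**: integrals of configuration functionals are invariant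
under the image map of a volume-preserving homeomorphism (no integrability hypothesis: the image
map is a measurable embedding). [folklore] -/
theorem integral_comp_mapHomeomorph_eq (P : Measure (PointConfig ℂ))
    (hP : IsPoissonPointProcess (volume : Measure ℂ) P) (e : ℂ ≃ₜ ℂ)
    (he : Measure.map e (volume : Measure ℂ) = volume) (F : PointConfig ℂ → ℝ) :
    ∫ c, F (c.mapHomeomorph e) ∂P = ∫ c, F c ∂P := by
  rw [← (PointConfig.measurableEmbedding_mapHomeomorph e).integral_map,
    poisson_map_mapHomeomorph_eq P hP e he]

/-- **`TwistInvariance`**: the pair law of two independent Poisson processes of Lebesgue intensity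
(black and white nuclei of the annealed Poisson–Voronoi model) is invariant under the simultaneous
image map of a volume-preserving homeomorphism. [folklore] -/
theorem poissonPair_map_mapHomeomorph_eq (PB PW : Measure (PointConfig ℂ))
    (hB : IsPoissonPointProcess (volume : Measure ℂ) PB)
    (hW : IsPoissonPointProcess (volume : Measure ℂ) PW) (e : ℂ ≃ₜ ℂ)
    (he : Measure.map e (volume : Measure ℂ) = volume) :
    (PB.prod PW).map (Prod.map (PointConfig.mapHomeomorph e) (PointConfig.mapHomeomorph e))
      = PB.prod PW := by
  haveI := hB.isProbabilityMeasure
  haveI := hW.isProbabilityMeasure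
  rw [← Measure.map_prod_map _ _ (PointConfig.measurable_mapHomeomorph e)
      (PointConfig.measurable_mapHomeomorph e),
    poisson_map_mapHomeomorph_eq PB hB e he, poisson_map_mapHomeomorph_eq PW hW e he]

/-- The corresponding invariance of annealed expectations of pair functionals (e.g. crossing
indicators of the Voronoi colouring, flip-rate-weighted four-arm sums). [folklore] -/
theorem integral_comp_prodMap_mapHomeomorph_eq (PB PW : Measure (PointConfig ℂ))
    (hB : IsPoissonPointProcess (volume : Measure ℂ) PB)
    (hW : IsPoissonPointProcess (volume : Measure ℂ) PW) (e : ℂ ≃ₜ ℂ)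
    (he : Measure.map e (volume : Measure ℂ) = volume)
    (F : PointConfig ℂ × PointConfig ℂ → ℝ) :
    ∫ c, F (c.1.mapHomeomorph e, c.2.mapHomeomorph e) ∂(PB.prod PW) = ∫ c, F c ∂(PB.prod PW) := by
  have hemb : MeasurableEmbedding
      (Prod.map (PointConfig.mapHomeomorph e) (PointConfig.mapHomeomorph e) :
        PointConfig ℂ × PointConfig ℂ → PointConfig ℂ × PointConfig ℂ) :=
    (PointConfig.measurableEmbedding_mapHomeomorph e).prodMap
      (PointConfig.measurableEmbedding_mapHomeomorph e)
  have h1 := hemb.integral_map (μ := PB.prod PW) F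
  rw [poissonPair_map_mapHomeomorph_eq PB PW hB hW e he] at h1
  simpa only [Prod.map] using h1.symm

end Summit.CriticalPhenomena.CardyFormulaZ2.Theorems

end
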